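import Mathlib
import Summits.QuantumAdvantage.QuantumAdvantage.Theorems.LinnikCubicClassGroupsPureCubicClassNumberHardHondaTwoInertSetup
import Summits.QuantumAdvantage.QuantumAdvantage.Theorems.LinnikCubicClassGroupsPureCubicClassNumberHardThreeRamifiedCell
import Summits.QuantumAdvantage.QuantumAdvantage.Theorems.LinnikCubicClassGroupsPureCubicClassNumberHardStubInvariantIdealsPrincipal
import HarnessLib

/-!
# Honda 1971 for `m = pq`, `p, q ≡ 2 (mod 3)`, `pq ≢ ±1 (mod 9)`: `3 ∣ h(ℚ(∛(pq)))` (Hasse-free)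

Route `LinnikCubicClassGroups` (rank-0 hypothesis-type target `PureCubicClassNumberHard`,
stmt-QuantumAdvantage-11826): classical arithmetic of the pure cubic fields `ℚ(∛m)`.

* `three_dvd_classNumber_of_two_inert_primes` — **for distinct primes `p, q ≡ 2 (mod 3)` with
  `pq ≢ ±1 (mod 9)` and every cubic number field `K ∋ ∛(pq)`: `3 ∣ h(K)`** (Honda 1971, Theorem:
  the conductor `3pq` / `9pq` of `ℚ(∛(pq), ζ₃)/ℚ(ζ₃)` is not exceptional;
  [AouissiMayerIsmailiTalbiAzizi2020, Thm. 2.3]).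

The proof avoids every norm theorem (no Hasse, no Hilbert 90 for ideals): in `L = K(ζ₃)/F = ℚ(ζ₃)`
the primes `P₁ ∋ p`, `P₂ ∋ q` and the wild prime `𝔏 ∋ 3` are totally ramified, so by
`exists_nonprincipal_cell` (`…ThreeRamifiedCell.lean`, a count of `Ĥ⁻¹(σ, 𝓞_Lˣ)`) some
`J = P₁^a P₂^b 𝔏^d` is not principal; the `K`-ideal `j = 𝔭_p^a 𝔭_q^b 𝔮^{d'}` (`𝔭_p = (p, ∛(pq))`,
`3𝓞_K = 𝔮³`, `2d' ≡ d (mod 3)`) extends to `J · λ^k 𝓞_L`, hence is not principal, while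
`j³` is principal: its class has order `3`.

HONEST FRAMING (block-2b rule): a kernel-checked classical theorem (Honda 1971) about class numbers
of pure cubic fields — an independent certification, NOT summit progress; the crux
`PureCubicClassNumberHard` is hypothesis-type and untouched.

## References
* T. Honda, *Pure cubic fields whose class numbers are multiples of three*, J. Number Theory 3
  (1971) 7–12, Theorem. [Honda1971]
* P. Barrucand, H. Cohn, *A rational genus, class number divisibility, and unit theory for pure
  cubic fields*, J. Number Theory 2 (1970) 7–21. [BarrucandCohn1970]
* S. Aouissi, D. C. Mayer, M. C. Ismaili, M. Talbi, A. Azizi, Period. Math. Hungar. 81 (2020),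
  Thm. 2.3. [AouissiMayerIsmailiTalbiAzizi2020]
-/

set_option linter.dupNamespace false

noncomputable section

open NumberField Polynomial

open scoped Pointwise NumberField IntermediateField

namespace Summit.QuantumAdvantage.QuantumAdvantage.Theorems.LinnikCubicClassGroups

open Literature.NumberTheory.NumberFields IsDedekindDomain

/-! ### Honda's criterion, conductor `3pq` / `9pq`: two inert primes and the wild prime -/

/-- **Honda's criterion, case `m = pq` with `p, q ≡ 2 (mod 3)` and `pq ≢ ±1 (mod 9)`** (Honda 1971,
Theorem; [AouissiMayerIsmailiTalbiAzizi2020, Thm. 2.3]: the conductor `3pq` or `9pq` of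
`ℚ(∛(pq), ζ₃)/ℚ(ζ₃)` is not in the exceptional list): for every cubic number field `K ∋ ∛(pq)`,
`3 ∣ h(K)`.  Proof, WITHOUT any norm theorem: in `L = K(ζ₃)/F = ℚ(ζ₃)` the three primes `P₁ ∋ p`,
`P₂ ∋ q` (inert, totally ramified) and the wild prime `𝔏 ∋ 3` (Dedekind's first species) ramify;
by `exists_nonprincipal_cell` some `J = P₁^a P₂^b 𝔏^d` is not principal; with the primes
`𝔭_p = (p, ∛(pq))`, `𝔭_q`, `𝔮` (`3𝓞_K = 𝔮³`) of `K` one has `𝔭_p𝓞_L = P₁`, `𝔭_q𝓞_L = P₂`,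
`𝔮𝓞_L = 𝔏²`, so `j = 𝔭_p^a 𝔭_q^b 𝔮^{d'}` (`2d' ≡ d (mod 3)`) satisfies `j𝓞_L = J · (λ)^k`, hence `j`
is not principal while `j³ = (p^a q^b 3^{d'})` is: the class of `j` has order `3` in `Cl(K)`.
[cite: Honda1971, Theorem] [cite: AouissiMayerIsmailiTalbiAzizi2020, Thm. 2.3] -/
theorem three_dvd_classNumber_of_two_inert_primes (p q : ℕ) (hp : p.Prime) (hq : q.Prime)
    (hpq : p ≠ q) (hp3 : p % 3 = 2) (hq3 : q % 3 = 2) (h91 : (p * q) % 9 ≠ 1)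
    (h98 : (p * q) % 9 ≠ 8) (K : Type) [Field K] [NumberField K] (hK : Module.finrank ℚ K = 3)
    (hα : ∃ α : K, α ^ 3 = ((p * q : ℕ) : K)) : 3 ∣ classNumber K := by
  classical
  obtain ⟨α, hα⟩ := hα
  have hpq3 : ¬ 3 ∣ p * q := by
    intro h
    rcases (Nat.Prime.dvd_mul Nat.prime_three).mp h with h | h
    · have := (Nat.prime_dvd_prime_iff_eq Nat.prime_three hp).mp h; omega
    · have := (Nat.prime_dvd_prime_iff_eq Nat.prime_three hq).mp h; omega
  obtain ⟨hKL, hL6, hGal, F, hgal, hFL, hF2, ⟨σ, hσ⟩, hPID, hcplx, ⟨θ, hθ, hθdeg⟩, ζ, hζ3, hζ1,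
    hζeq, hunits, P₁, P₂, hP₁, hP₂, h12, hpP₁, hqP₂, hspan₁, hspan₂, he₁, he₂⟩ :=
    fieldSetup_twoPrimes hp hq hpq hp3 hq3 K hK hα (CyclotomicField 3 K)
  haveI := hgal
  haveI := hGal
  obtain ⟨Q, hQ, h3Q, heQ, hQuniq, ⟨t₃, ht₃⟩, hspan₃⟩ :=
    exists_wild_prime_of_mod_nine hpq3 h91 h98 hK hα hL6 F hFL hF2 hζeq hPID
  -- `Q` differs from `P₁`, `P₂`
  have hcop3 : ∀ {r : ℕ}, r.Prime → r % 3 = 2 → ∀ {P : Ideal (𝓞 (CyclotomicField 3 K))}, P.IsMaximal →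
      (r : 𝓞 (CyclotomicField 3 K)) ∈ P → P ≠ Q := by
    intro r hr hr3 P hP hrP hPQ
    subst hPQ
    have hcop : IsCoprime (r : 𝓞 (CyclotomicField 3 K)) (3 : 𝓞 (CyclotomicField 3 K)) := by
      have h' : IsCoprime (r : ℤ) (3 : ℤ) :=
        Nat.isCoprime_iff_coprime.mpr ((Nat.coprime_primes hr Nat.prime_three).mpr (by omega))
      simpa using h'.map (Int.castRingHom (𝓞 (CyclotomicField 3 K)))
    obtain ⟨a, b, hab⟩ := hcop
    exact hP.ne_top ((Ideal.eq_top_iff_one _).mpr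
      (hab ▸ P.add_mem (P.mul_mem_left a hrP) (P.mul_mem_left b h3Q)))
  have h1Q : P₁ ≠ Q := hcop3 hp hp3 hP₁ hpP₁
  have h2Q : P₂ ≠ Q := hcop3 hq hq3 hP₂ hqP₂
  have ht₁ : Ideal.span {algebraMap (𝓞 F) (𝓞 (CyclotomicField 3 K)) (p : 𝓞 F)} = P₁ ^ 3 := by simpa using hspan₁
  have ht₂ : Ideal.span {algebraMap (𝓞 F) (𝓞 (CyclotomicField 3 K)) (q : 𝓞 F)} = P₂ ^ 3 := by simpa using hspan₂
  have hgen : ∀ w : (𝓞 F)ˣ, ∃ i : ℕ, ∃ v : (𝓞 F)ˣ, w = ζ ^ i * v ^ 3 := by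
    intro w
    obtain ⟨i, hi | hi⟩ := hunits w
    · exact ⟨i, 1, by rw [hi]; simp⟩
    · exact ⟨i, -1, by rw [hi]; norm_num⟩
  -- a non-principal cell
  obtain ⟨a, b, d, ha, hb, hd, hJ⟩ :=
    exists_nonprincipal_cell F (CyclotomicField 3 K) σ hσ hFL hcplx ζ hgen hP₁ hP₂ hQ h12 h1Q h2Q he₁ he₂ heQ
      ht₁ ht₂ ht₃
  -- the primes of `K`
  obtain ⟨θK, hθK⟩ := Honda1971.exists_ringOfIntegers_coe_eq_of_pow_three
    (m := p * q) (K := K) (by exact_mod_cast hα)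
  have hθK3 : θK ^ 3 = (p : 𝓞 K) * (q : 𝓞 K) := by
    apply RingOfIntegers.coe_injective
    have h := hα
    rw [← hθK] at h
    push_cast at h ⊢
    exact_mod_cast h
  have hbez : ∀ {r s : ℕ}, r.Prime → s.Prime → r ≠ s →
      ∃ a b : 𝓞 K, a * (r : 𝓞 K) ^ 2 + b * (s : 𝓞 K) = 1 := by
    intro r s hr hs hrs
    have hcop : IsCoprime ((r : ℤ) ^ 2) (s : ℤ) :=
      (Nat.isCoprime_iff_coprime.mpr ((Nat.coprime_primes hr hs).mpr hrs)).pow_left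
    obtain ⟨a, b, hab⟩ := hcop
    exact ⟨a, b, by exact_mod_cast hab⟩
  obtain ⟨a₁, b₁, hab₁⟩ := hbez hp hq hpq
  obtain ⟨a₂, b₂, hab₂⟩ := hbez hq hp hpq.symm
  set 𝔭₁ : Ideal (𝓞 K) := Ideal.span {(p : 𝓞 K), θK} with h𝔭₁
  set 𝔭₂ : Ideal (𝓞 K) := Ideal.span {(q : 𝓞 K), θK} with h𝔭₂
  have h𝔭₁3 : 𝔭₁ ^ 3 = Ideal.span {(p : 𝓞 K)} :=
    Honda1971.span_pair_pow_three_eq_span hθK3 hab₁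
  have h𝔭₂3 : 𝔭₂ ^ 3 = Ideal.span {(q : 𝓞 K)} :=
    Honda1971.span_pair_pow_three_eq_span (by rw [hθK3, mul_comm]) hab₂
  obtain ⟨𝔮, h𝔮max, h3𝔮, h𝔮3⟩ := exists_span_three_eq_cube hpq3 h91 h98 hK hα
  -- their extensions to `L`
  have hmap₁ : 𝔭₁.map (algebraMap (𝓞 K) (𝓞 (CyclotomicField 3 K))) = P₁ := by
    refine eq_pow_of_pow_three_eq hP₁ (Ideal.IsMaximal.ne_bot_of_isIntegral_int P₁) (n := 1) ?_
      |>.trans (pow_one _)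
    rw [← Ideal.map_pow, h𝔭₁3, Ideal.map_span, Set.image_singleton, map_natCast, hspan₁]
  have hmap₂ : 𝔭₂.map (algebraMap (𝓞 K) (𝓞 (CyclotomicField 3 K))) = P₂ := by
    refine eq_pow_of_pow_three_eq hP₂ (Ideal.IsMaximal.ne_bot_of_isIntegral_int P₂) (n := 1) ?_
      |>.trans (pow_one _)
    rw [← Ideal.map_pow, h𝔭₂3, Ideal.map_span, Set.image_singleton, map_natCast, hspan₂]
  have hmap₃ : 𝔮.map (algebraMap (𝓞 K) (𝓞 (CyclotomicField 3 K))) = Q ^ 2 := by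
    refine eq_pow_of_pow_three_eq hQ (Ideal.IsMaximal.ne_bot_of_isIntegral_int Q) (n := 2) ?_
    rw [← Ideal.map_pow, ← h𝔮3, Ideal.map_span, Set.image_singleton, map_ofNat, hspan₃]
  -- the descended ideal `j = 𝔭₁^a 𝔭₂^b 𝔮^{d'}`, `2 d' = d + 3 k`
  obtain ⟨d', k, hd', hdk⟩ : ∃ d' k : ℕ, d' < 3 ∧ 2 * d' = d + 3 * k := by
    interval_cases d
    · exact ⟨0, 0, by norm_num, by norm_num⟩
    · exact ⟨2, 1, by norm_num, by norm_num⟩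
    · exact ⟨1, 0, by norm_num, by norm_num⟩
  set j : Ideal (𝓞 K) := 𝔭₁ ^ a * 𝔭₂ ^ b * 𝔮 ^ d' with hjdef
  have hjmap : j.map (algebraMap (𝓞 K) (𝓞 (CyclotomicField 3 K))) =
      Ideal.span {algebraMap (𝓞 F) (𝓞 (CyclotomicField 3 K)) (t₃ ^ k)} * (P₁ ^ a * P₂ ^ b * Q ^ d) := by
    rw [hjdef, Ideal.map_mul, Ideal.map_mul, Ideal.map_pow, Ideal.map_pow, Ideal.map_pow, hmap₁,
      hmap₂, hmap₃, ← pow_mul, map_pow, ← Ideal.span_singleton_pow, ht₃, ← pow_mul,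
      show 2 * d' = d + 3 * k from hdk, pow_add]
    ring
  -- `j` is not principal, but `j³` is
  have hne3 : ∀ {I : Ideal (𝓞 K)} {r : ℕ}, r ≠ 0 → I ^ 3 = Ideal.span {(r : 𝓞 K)} → I ≠ ⊥ := by
    intro I r hr h hI
    rw [hI, ← Ideal.zero_eq_bot, zero_pow (by norm_num), Ideal.zero_eq_bot, eq_comm,
      Ideal.span_singleton_eq_bot] at h
    exact (show (r : 𝓞 K) ≠ 0 by exact_mod_cast hr) h
  have h𝔭₁0 : 𝔭₁ ≠ ⊥ := hne3 hp.ne_zero h𝔭₁3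
  have h𝔭₂0 : 𝔭₂ ≠ ⊥ := hne3 hq.ne_zero h𝔭₂3
  haveI := h𝔮max
  have h𝔮0 : 𝔮 ≠ ⊥ := Ideal.IsMaximal.ne_bot_of_isIntegral_int 𝔮
  have hj0 : j ≠ ⊥ :=
    mul_ne_zero (mul_ne_zero (pow_ne_zero _ h𝔭₁0) (pow_ne_zero _ h𝔭₂0)) (pow_ne_zero _ h𝔮0)
  have hjnp : ¬ Submodule.IsPrincipal j := by
    intro hpr
    obtain ⟨x, hx⟩ := hpr.principal
    rw [Ideal.submodule_span_eq] at hx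
    have hmx : j.map (algebraMap (𝓞 K) (𝓞 (CyclotomicField 3 K))) = Ideal.span {algebraMap (𝓞 K) (𝓞 (CyclotomicField 3 K)) x} := by
      rw [hx, Ideal.map_span, Set.image_singleton]
    rw [hjmap] at hmx
    have hx0 : algebraMap (𝓞 K) (𝓞 (CyclotomicField 3 K)) x ≠ 0 := by
      intro h0
      apply hj0
      rw [hx, Ideal.span_singleton_eq_bot]
      exact (map_eq_zero_iff _ (RingOfIntegers.algebraMap.injective K (CyclotomicField 3 K))).mp h0
    exact hJ (isPrincipal_of_span_singleton_eq_mul hmx.symm hx0)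
  have hj3 : Submodule.IsPrincipal (j ^ 3) := by
    have : j ^ 3 = Ideal.span {(p : 𝓞 K) ^ a * (q : 𝓞 K) ^ b * (3 : 𝓞 K) ^ d'} := by
      rw [hjdef, mul_pow, mul_pow, ← pow_mul, ← pow_mul, ← pow_mul, mul_comm a 3, mul_comm b 3,
        mul_comm d' 3, pow_mul, pow_mul, pow_mul, h𝔭₁3, h𝔭₂3, ← h𝔮3, Ideal.span_singleton_pow,
        Ideal.span_singleton_pow, Ideal.span_singleton_pow, Ideal.span_singleton_mul_span_singleton,
        Ideal.span_singleton_mul_span_singleton]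
    rw [this]
    infer_instance
  -- the class of `j` has order `3`
  have hjmem : j ∈ nonZeroDivisors (Ideal (𝓞 K)) := mem_nonZeroDivisors_of_ne_zero hj0
  set c : ClassGroup (𝓞 K) := ClassGroup.mk0 ⟨j, hjmem⟩ with hcdef
  have hc1 : c ≠ 1 := by
    rw [hcdef, Ne, ClassGroup.mk0_eq_one_iff]
    exact hjnp
  have hc3 : c ^ 3 = 1 := by
    rw [hcdef, ← map_pow]
    have : (⟨j, hjmem⟩ : nonZeroDivisors (Ideal (𝓞 K))) ^ 3 = ⟨j ^ 3, pow_mem hjmem 3⟩ := rfl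
    rw [this, ClassGroup.mk0_eq_one_iff]
    exact hj3
  have hord : orderOf c = 3 := orderOf_eq_prime hc3 hc1
  rw [classNumber, ← hord]
  exact orderOf_dvd_card

end Summit.QuantumAdvantage.QuantumAdvantage.Theorems.LinnikCubicClassGroups

end
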